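import Summits.BirchSwinnertonDyer.Rank1Residual.X11b.KummerLocalIndex
import Literature.NumberTheory.EllipticCurves.KummerSelmerStructure
import Literature.NumberTheory.EllipticCurves.ComplexMultiplication
import Literature.NumberTheory.EllipticCurves.LeadingTermHeegnerProofs
import HarnessLib

/-!
# Route `ByReductionTypeAtTwo` (rung K4), crux `SupersingularRankZeroAtTwo` (item stmt-BirchSwinnertonDyer-19097), line
# `odd_blind_package`, slot 5 CDC_H, binder (hglob)/(P2) of the position glue (★★ p816472): **THE GLOBAL KUMMER CLASS OF A
# GENERATOR** — for `E/ℚ` of rank `1` with `E(ℚ)[p] = 0` and `P₁` a generator modulo torsion, the Kummer class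
# `δ = κ_{p^J}(P₁) ∈ H¹(ℚ, E[p^J])` has order exactly `p^J` and lies in the Kummer Selmer group (the object `δ` of the abstract
# position core ★ p816628) (cell `bsd-2adic`, LEAD ss-1 GEN 21; memo `HOME/ss/gen21/HAND-TARGETS-CDC-4.md` 4c)

HONEST FRAMING: THEOREMS ONLY (no definition, no named fact, no `sorry`); helpers toward (hglob). Tree inputs: the Kummer map
`kummerMapTorsion` with `kummerMapTorsion_ker` (Silverman VIII.§2) and `kummerMapTorsion_mem_selmerLocalKer`, the identification
`selmerGroup_eq_selmerGroup_kummerSelmerStructure`. Nothing is booked; 19097 stays OPEN; BSD is proved for no curve. bears_on: K4 (19097).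
References: [SilvermanAEC2009] VIII.§2, X.§4.
-/

set_option autoImplicit false
set_option linter.dupNamespace false

noncomputable section

open scoped Classical NumberField

namespace Summit.BirchSwinnertonDyer.BirchSwinnertonDyer.Theorems

namespace OddBlindLocal

open NumberField IsDedekindDomain WeierstrassCurve Literature.NumberTheory.EllipticCurves Field
open Literature Literature.NumberTheory.GaloisRepresentations

/-- **A generator modulo torsion of a rank-one Mordell–Weil group has infinite order.** [folklore] -/
theorem not_isOfFinAddOrder_of_generator {K : Type} [Field K] (E : WeierstrassCurve K) (hr : E.mordellWeilRank = 1)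
    (P₁ : E.toAffine.Point)
    (hgen : ∀ P : E.toAffine.Point, ∃ (a : ℤ) (t : E.toAffine.Point), IsOfFinAddOrder t ∧ P = a • P₁ + t) :
    ¬ IsOfFinAddOrder P₁ := by
  intro h
  have hr' : 1 ≤ Module.finrank ℤ E.toAffine.Point := by
    have h := hr
    unfold WeierstrassCurve.mordellWeilRank at h
    have h' : Module.finrank ℤ E.toAffine.Point = 1 := by convert h
    omega
  obtain ⟨P, hP⟩ := Literature.NumberTheory.EllipticCurves.exists_not_isOfFinAddOrder_of_one_le_finrank hr'
  obtain ⟨a, t, ht, rfl⟩ := hgen P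
  exact hP ((h.zsmul).add ht)

/-- **The Kummer class of a generator has order exactly `p^J`** in `H¹(ℚ, E[p^J])`, in the instance-safe form
`κ(m • P₁) = 0 ↔ p^J ∣ m` (no scalar action on `H¹` is mentioned; generic number field `K` with the classical `DecidableEq` of the Literature
Kummer map — over `ℚ` bridge `instDecidableEqRat` with `convert`): exactness of the Kummer sequence at `E(ℚ)/p^J`
(Silverman VIII.§2) and `E(ℚ) = ℤ P₁ + E(ℚ)_tors` with `P₁` of infinite order (`rank E(ℚ) = 1`). [cite: SilvermanAEC2009, VIII.§2] -/
theorem kummerMapTorsion_zsmul_generator_eq_zero_iff {K : Type} [Field K] [NumberField K] (E : WeierstrassCurve K) [E.IsElliptic]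
    {p : ℕ} (hr : E.mordellWeilRank = 1) (P₁ : E.toAffine.Point)
    (hgen : ∀ P : E.toAffine.Point, ∃ (a : ℤ) (t : E.toAffine.Point), IsOfFinAddOrder t ∧ P = a • P₁ + t)
    (J : ℕ) (hdiv : ∀ P : geomPoints E, ∃ Q : geomPoints E, ((p ^ J : ℕ) : ℤ) • Q = P) (m : ℤ) :
    kummerMapTorsion E ((p ^ J : ℕ) : ℤ) hdiv (m • P₁) = 0 ↔ ((p ^ J : ℕ) : ℤ) ∣ m := by
  have hP₁ := not_isOfFinAddOrder_of_generator E hr P₁ hgen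
  constructor
  · intro h0
    have hmem : m • P₁ ∈ (kummerMapTorsion E ((p ^ J : ℕ) : ℤ) hdiv).ker := (AddMonoidHom.mem_ker).mpr h0
    rw [kummerMapTorsion_ker] at hmem
    obtain ⟨Q, hQ⟩ := hmem
    change ((p ^ J : ℕ) : ℤ) • Q = m • P₁ at hQ
    obtain ⟨a, t, ht, rfl⟩ := hgen Q
    -- `(p^J a − m) • P₁ = −p^J • t` is torsion, so `p^J a = m`
    have htor : IsOfFinAddOrder ((((p ^ J : ℕ) : ℤ) * a - m) • P₁) := by
      have h1 : (((p ^ J : ℕ) : ℤ) * a - m) • P₁ = -(((p ^ J : ℕ) : ℤ) • t) := by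
        rw [sub_zsmul, mul_zsmul, ← hQ, zsmul_add]
        abel
      rw [h1]
      exact (ht.zsmul).neg
    have hzero : ((p ^ J : ℕ) : ℤ) * a - m = 0 := by
      by_contra hne
      exact hP₁ (Literature.NumberTheory.EllipticCurves.isOfFinAddOrder_of_zsmul hne htor)
    exact ⟨a, by linarith⟩
  · rintro ⟨a, rfl⟩
    have hmem : (((p ^ J : ℕ) : ℤ) * a) • P₁ ∈ (kummerMapTorsion E ((p ^ J : ℕ) : ℤ) hdiv).ker := by
      rw [kummerMapTorsion_ker]
      exact ⟨a • P₁, by change ((p ^ J : ℕ) : ℤ) • (a • P₁) = _; rw [← mul_zsmul]⟩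
    exact (AddMonoidHom.mem_ker).mp hmem

/-- **Kummer classes are Selmer classes**: `κ(P) ∈ H¹_𝓚(K, E[n])` for the Kummer Selmer structure `𝓚` (Silverman X.§4 (**): the local
Kummer condition holds at every place). [cite: SilvermanAEC2009, X.§4 diagram (**)] -/
theorem kummerMapTorsion_mem_selmerGroup_kummerSelmerStructure {K : Type} [Field K] [NumberField K] (E : WeierstrassCurve K)
    [E.IsElliptic] {n : ℤ} (hdiv : ∀ P : geomPoints E, ∃ Q : geomPoints E, n • Q = P) (P : E.toAffine.Point) :
    kummerMapTorsion E n hdiv P ∈ (E.kummerSelmerStructure n).selmerGroup := by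
  rw [← selmerGroup_eq_selmerGroup_kummerSelmerStructure]
  exact (mem_selmerGroup_iff E _ _).mpr
    ⟨fun v ↦ kummerMapTorsion_mem_selmerLocalKer E _ hdiv _ P, fun w ↦ kummerMapTorsion_mem_selmerLocalKer E _ hdiv _ P⟩

/-- **Localisation of the Kummer class of `P` at a finite place is the local Kummer class of `P ⊗ K_v`** (tree
`KummerIndex.res_kummerMapTorsion_eq_localKummerMap`, read at `Place.Completion (Sum.inr v) = K_v`). [cite: SilvermanAEC2009, X.§4 diagram (**)] -/
theorem localization_inr_kummerMapTorsion {K : Type} [Field K] [NumberField K] (E : WeierstrassCurve K) [E.IsElliptic]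
    {n : ℤ} (hn : n ≠ 0) (hdiv : ∀ P : geomPoints E, ∃ Q : geomPoints E, n • Q = P) (v : HeightOneSpectrum (𝓞 K))
    (P : E.toAffine.Point) :
    galoisCohomology.localization (E.torsionGaloisModule n) (Sum.inr v : Place K) 1 (kummerMapTorsion E n hdiv P) =
      E.localKummerMap (v.adicCompletion K) hn (Affine.Point.baseChange (W' := E) K (v.adicCompletion K) P) :=
  Summit.BirchSwinnertonDyer.Rank1Residual.X11b.KummerIndex.res_kummerMapTorsion_eq_localKummerMap E _ hn hdiv P

end OddBlindLocal

end Summit.BirchSwinnertonDyer.BirchSwinnertonDyer.Theorems
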